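import Summits.HubbardSuperconductivity.HubbardSuperconductivity.Theorems.AnisotropyChordFerroSideChordFour

/-!
# Route `AnisotropyChord` / the `4 × 4` torus: the reduced quadratic forms for EVERY SYMMETRIC sector-`0` amplitude
# (prover seat `hubbard-h0-rotor-p1` g18; generalises `…FourTorusClasses` / `…FourTorusFormsB` from the Perron amplitude to the
# symmetric subspace, as needed for spectral (gap / perturbation) arguments on the `4 × 4` torus)

`SymAmp a`: a real amplitude on the `4 × 4` torus that is invariant under the 384 lattice automorphisms `sitePerm p m`, under the
global spin flip, and supported on the sector `Sᶻ_tot = 0` (eight zeros).  Every sector-`0` Perron amplitude is one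
(`symAmp_of_perron`), and `SymAmp` is a linear condition (`SymAmp.lin`).  For such `a` with class values `v r = a (decode (rep8 r))`:
`Σ a² = N(v)`, `Σ W a² = W(v)`, `‖S⁻a‖² = L(v)`, `Σ a·(A a) = A(v)` — the same class-variable forms as in the Perron case (the g17
proofs verbatim, with the Perron hypothesis replaced by the three symmetry facts it was used for), and the pairing with a class
function `Σ_σ a σ · g(cls σ) = Σ_r n8 r · v r · g r` (`sum_mul_classFun`).
-/

set_option linter.style.longLine false
set_option linter.dupNamespace false
set_option autoImplicit false

open Finset
open Literature.MathematicalPhysics.QuantumLattice Literature.Probability.LatticeModels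
open Summit.HubbardSuperconductivity.HubbardSuperconductivity.Theorems.AnisotropyChord.Tower
open Summit.HubbardSuperconductivity.HubbardSuperconductivity.Theorems.AnisotropyChord.InsertionEntropy

namespace Summit.HubbardSuperconductivity.HubbardSuperconductivity.Theorems.AnisotropyChord.FourTorus

/-- **a symmetric sector-`0` amplitude on the `4 × 4` torus:** invariant under the 384 automorphisms `sitePerm p m` and the global
flip, supported on the configurations with eight zeros. [folklore] -/
structure SymAmp (a : Cfg → ℝ) : Prop where
  perm : ∀ (p m : ℕ) (hp : p < 24) (hm : m < 16) (σ : Cfg), a (σ ∘ ⇑(sitePerm p m hp hm).symm) = a σ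
  flip : ∀ σ, a (flipAll σ) = a σ
  supp : ∀ σ, a σ ≠ 0 → zerosCard σ = 8

/-- every sector-`0` Perron amplitude of `H₄(Δ)` is symmetric. [folklore] -/
theorem symAmp_of_perron {Δ : ℝ} {a : Cfg → ℝ} (ha : IsPerronSectorGroundAmplitude 4 Δ 0 a) : SymAmp a where
  perm := fun p m hp hm σ => perron_comp_sitePerm_symm ha hp hm σ
  flip := perron_flipAll ha
  supp := fun σ hσ => by have h := perron_support ha σ hσ; rw [card_V4] at h; norm_num at h; exact h

/-- `SymAmp` is a linear condition. [folklore] -/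
theorem SymAmp.lin {a b : Cfg → ℝ} (ha : SymAmp a) (hb : SymAmp b) (α β : ℝ) : SymAmp (fun σ => α * a σ + β * b σ) where
  perm := fun p m hp hm σ => by simp only [ha.perm, hb.perm]
  flip := fun σ => by simp only [ha.flip, hb.flip]
  supp := fun σ hσ => by
    by_cases h1 : a σ = 0
    · by_cases h2 : b σ = 0
      · exfalso; apply hσ; simp [h1, h2]
      · exact hb.supp σ h2
    · exact ha.supp σ h1

variable {a : Cfg → ℝ}

/-- a symmetric amplitude vanishes off the weight-8 codes. [folklore] -/
theorem SymAmp.decode_eq_zero (ha : SymAmp a) {k : ℕ} (hk : k < 65536) (hpop : pop16 k ≠ 8) : a (decode k) = 0 := by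
  by_contra hne
  have h := ha.supp _ hne
  exact hpop ((zerosCard_decode_eq_eight_iff hk).1 h)

/-- a symmetric amplitude is constant along the code action (`t < 768`). [folklore] -/
theorem SymAmp.decode_actCode (ha : SymAmp a) {t : ℕ} (ht : t < 768) (k : ℕ) : a (decode (actCode t k)) = a (decode k) := by
  rcases Nat.mod_two_eq_zero_or_one t with he | ho
  · rw [decode_actCode_even ht he, ha.perm]
  · rw [decode_actCode_odd ht ho, ha.flip, ha.perm]

/-- **class value:** on a weight-8 code a symmetric amplitude equals its value at the class representative. [folklore] -/
theorem SymAmp.classValue (ha : SymAmp a) {k : ℕ} (hk : k < 65536) (hpop : pop16 k = 8) :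
    a (decode k) = a (decode (rep8 (cls k))) := by
  obtain ⟨-, hw, hact⟩ := check8_facts hk hpop
  have h := ha.decode_actCode hw (rep8 (cls k))
  rwa [hact] at h

/-- **the norm in class variables** for a symmetric amplitude. [folklore] -/
theorem SymAmp.sum_sq_eq_classes (ha : SymAmp a) :
    ∑ σ, a σ ^ 2 = ∑ r ∈ range 58, (n8 r : ℝ) * a (decode (rep8 r)) ^ 2 := by
  rw [sum_config_eq_sum_range, ← sum_sector8]
  refine Finset.sum_congr rfl fun k hk => ?_
  by_cases hp : pop16 k = 8
  · rw [if_pos hp, ha.classValue (mem_range.1 hk) hp]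
  · rw [if_neg hp, ha.decode_eq_zero (mem_range.1 hk) hp]; ring

/-- **pairing with a class function:** `Σ_σ a σ · G σ = Σ_r n8 r · v r · g r` whenever `G (decode k) = g (cls k)` on weight-8 codes. [folklore] -/
theorem SymAmp.sum_mul_classFun (ha : SymAmp a) (G : Cfg → ℝ) (g : ℕ → ℝ)
    (hG : ∀ k < 65536, pop16 k = 8 → G (decode k) = g (cls k)) :
    ∑ σ, a σ * G σ = ∑ r ∈ range 58, (n8 r : ℝ) * (a (decode (rep8 r)) * g r) := by
  rw [sum_config_eq_sum_range, ← sum_sector8]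
  refine Finset.sum_congr rfl fun k hk => ?_
  have hk' := mem_range.1 hk
  by_cases hp : pop16 k = 8
  · rw [if_pos hp, ha.classValue hk' hp, hG k hk' hp]
  · rw [if_neg hp, ha.decode_eq_zero hk' hp]; ring

/-- **the Ising form in class variables** for a symmetric amplitude. [folklore] -/
theorem SymAmp.sum_isingW_sq_eq_classes (ha : SymAmp a) :
    ∑ σ, isingW (torusGraph 2 4) σ * a σ ^ 2
      = ∑ r ∈ range 58, (n8 r : ℝ) * ((8 - (1/2 : ℝ) * (activeEdges r : ℝ)) * a (decode (rep8 r)) ^ 2) := by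
  rw [sum_config_eq_sum_range, ← sum_sector8]
  refine Finset.sum_congr rfl fun k hk => ?_
  have hk' := mem_range.1 hk
  by_cases hp : pop16 k = 8
  · rw [if_pos hp, isingW_four, brokenOrd_decode_class hk' hp, ← activeEdges_eq, ha.classValue hk' hp]
  · rw [if_neg hp, ha.decode_eq_zero hk' hp]; ring

/-- for EVEN `t` the value of a function invariant under the `sitePerm`s is preserved along the code action. [folklore] -/
theorem decode_actCode_even_comp' {β : Type} (F : Cfg → β)
    (hF : ∀ (p m : ℕ) (hp : p < 24) (hm : m < 16) (σ : Cfg), F (σ ∘ ⇑(sitePerm p m hp hm).symm) = F σ)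
    {t : ℕ} (ht : t < 768) (he : t % 2 = 0) (k : ℕ) : F (decode (actCode t k)) = F (decode k) := by
  rw [decode_actCode_even ht he]
  exact hF _ _ _ _ (decode k)

/-! ## `‖S⁻a‖²` -/

/-- `lowerSum a` vanishes off the weight-9 codes. [folklore] -/
theorem SymAmp.lowerSum_decode_eq_zero (ha : SymAmp a) {k : ℕ} (hk : k < 65536) (hpop : pop16 k ≠ 9) :
    lowerSum a (decode k) = 0 := by
  unfold lowerSum
  refine Finset.sum_eq_zero fun x _ => ?_
  split_ifs with hx
  · by_contra hne
    have h8 := ha.supp _ hne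
    rw [zerosCard_update_zero _ _ hx, zerosCard_decode, ← pop16_eq_bitCount k hk] at h8
    have : (pop16 k : ℝ) = 9 := by linarith
    exact hpop (by exact_mod_cast this)
  · rfl

/-- `lowerSum a` is a class function on the weight-9 codes. [folklore] -/
theorem SymAmp.lowerSum_decode_class (ha : SymAmp a) {k : ℕ} (hk : k < 65536) (hpop : pop16 k = 9) :
    lowerSum a (decode k) = lowerSum a (decode (rep9 (cls9 k))) := by
  obtain ⟨-, hw, he, hact⟩ := check9_facts hk hpop
  conv_lhs => rw [← hact]
  exact decode_actCode_even_comp' (lowerSum a)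
    (fun p m hp hm σ => lowerSum_comp_equiv (sitePerm p m hp hm).symm a (fun τ => ha.perm p m hp hm τ) σ) hw he _

/-- at the representative: `lowerSum a (decode (rep9 ρ)) = Σ_{c ∈ children ρ} v c`. [folklore] -/
theorem SymAmp.lowerSum_decode_rep9 (ha : SymAmp a) {ρ : ℕ} (hρ : ρ < 56) :
    lowerSum a (decode (rep9 ρ)) = ((children ρ).map fun c => a (decode (rep8 c))).sum := by
  obtain ⟨-, -, -, hch⟩ := rep9_facts hρ
  unfold children lowerSum
  rw [list_sum_filterMap, list_sum_range, ← sum_V4_eq]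
  refine Finset.sum_congr rfl fun x _ => ?_
  by_cases hx : Nat.testBit (rep9 ρ) (siteEquiv x) = true
  · obtain ⟨hp8, hlt⟩ := hch (siteEquiv x) (siteEquiv x).isLt hx
    rw [if_pos ((decode_eq_one_iff _ _).2 hx), hx, cond_true, Option.elim_some, decode_clearBit _ _ hx, ha.classValue hlt hp8]
  · have hx' : Nat.testBit (rep9 ρ) (siteEquiv x) = false := by simpa using hx
    rw [if_neg (fun h => hx ((decode_eq_one_iff _ _).1 h)), hx', cond_false, Option.elim_none]

/-- **the condensate in class variables** for a symmetric amplitude: `‖S⁻a‖² = Σ_ρ n9 ρ (Σ_{c ∈ children ρ} v c)²`. [folklore] -/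
theorem SymAmp.lowerNormSq_eq_classes (ha : SymAmp a) :
    lowerNormSq a = ∑ ρ ∈ range 56, (n9 ρ : ℝ) * ((children ρ).map fun c => a (decode (rep8 c))).sum ^ 2 := by
  unfold lowerNormSq
  rw [sum_config_eq_sum_range, ← sum_sector9]
  refine Finset.sum_congr rfl fun k hk => ?_
  have hk' := mem_range.1 hk
  by_cases hp : pop16 k = 9
  · rw [if_pos hp, ha.lowerSum_decode_class hk' hp, ha.lowerSum_decode_rep9 (check9_facts hk' hp).1]
  · rw [if_neg hp, ha.lowerSum_decode_eq_zero hk' hp]; ring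

/-! ## The graph form -/

/-- the pair form vanishes off the weight-9 codes. [folklore] -/
theorem SymAmp.pairForm_decode_eq_zero (ha : SymAmp a) {k : ℕ} (hk : k < 65536) (hpop : pop16 k ≠ 9) :
    pairForm a (decode k) = 0 := by
  unfold pairForm
  refine Finset.sum_eq_zero fun x _ => Finset.sum_eq_zero fun y _ => ?_
  split_ifs with h
  · obtain ⟨-, hx, hy⟩ := h
    have zero_of : ∀ z : V4, decode k z = 1 → a (Function.update (decode k) z 0) = 0 := by
      intro z hz
      by_contra hne
      have h8 := ha.supp _ hne
      rw [zerosCard_update_zero _ _ hz, zerosCard_decode, ← pop16_eq_bitCount k hk] at h8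
      have : (pop16 k : ℝ) = 9 := by linarith
      exact hpop (by exact_mod_cast this)
    rw [zero_of y hy, zero_of x hx]; ring
  · rfl

/-- the pair form is invariant under one automorphism under which the amplitude is invariant. [folklore] -/
theorem pairForm_comp_iso' {a : Cfg → ℝ} (φ : torusGraph 2 4 ≃g torusGraph 2 4) (ha : ∀ σ : Cfg, a (σ ∘ ⇑φ) = a σ)
    (τ : Cfg) : pairForm a (τ ∘ ⇑φ) = pairForm a τ := by
  unfold pairForm
  symm
  rw [← Equiv.sum_comp φ.toEquiv]
  refine Finset.sum_congr rfl fun x _ => ?_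
  rw [← Equiv.sum_comp φ.toEquiv]
  refine Finset.sum_congr rfl fun y _ => ?_
  have hadj : (torusGraph 2 4).Adj (φ x) (φ y) ↔ (torusGraph 2 4).Adj x y := φ.map_adj_iff
  have hx : φ.toEquiv x = φ x := rfl
  have hy : φ.toEquiv y = φ y := rfl
  have hupx : Function.update (τ ∘ ⇑φ) x 0 = Function.update τ (φ x) 0 ∘ ⇑φ := by
    rw [show (⇑φ : V4 → V4) = ⇑φ.toEquiv from rfl, Function.update_comp_equiv τ φ.toEquiv (φ.toEquiv x) 0,
      Equiv.symm_apply_apply]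
  have hupy : Function.update (τ ∘ ⇑φ) y 0 = Function.update τ (φ y) 0 ∘ ⇑φ := by
    rw [show (⇑φ : V4 → V4) = ⇑φ.toEquiv from rfl, Function.update_comp_equiv τ φ.toEquiv (φ.toEquiv y) 0,
      Equiv.symm_apply_apply]
  rw [hx, hy]
  by_cases h1 : (torusGraph 2 4).Adj x y <;> by_cases h2 : τ (φ x) = 1 <;> by_cases h3 : τ (φ y) = 1 <;>
    simp [Function.comp_apply, hadj, h1, h2, h3, hupx, hupy, ha]

/-- the pair form is a class function on the weight-9 codes. [folklore] -/
theorem SymAmp.pairForm_decode_class (ha : SymAmp a) {k : ℕ} (hk : k < 65536) (hpop : pop16 k = 9) :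
    pairForm a (decode k) = pairForm a (decode (rep9 (cls9 k))) := by
  obtain ⟨-, hw, he, hact⟩ := check9_facts hk hpop
  conv_lhs => rw [← hact]
  exact decode_actCode_even_comp' (pairForm a)
    (fun p m hp hm σ => pairForm_comp_iso' (siteIso p m hp hm).symm (fun τ => ha.perm p m hp hm τ) σ) hw he _

/-- at the representative: `D(decode (rep9 ρ)) = Σ_{(p,q) ∈ ordPairs ρ} (v p − v q)²`. [folklore] -/
theorem SymAmp.pairForm_decode_rep9 (ha : SymAmp a) {ρ : ℕ} (hρ : ρ < 56) :
    pairForm a (decode (rep9 ρ)) = ((ordPairs ρ).map fun pq => (a (decode (rep8 pq.1)) - a (decode (rep8 pq.2))) ^ 2).sum := by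
  obtain ⟨-, -, -, hch⟩ := rep9_facts hρ
  unfold ordPairs pairForm
  rw [list_sum_flatMap, list_sum_range, ← sum_V4_eq]
  refine Finset.sum_congr rfl fun x _ => ?_
  rw [list_sum_filterMap₂, list_sum_range, ← sum_V4_eq]
  refine Finset.sum_congr rfl fun y _ => ?_
  by_cases hadj : (torusGraph 2 4).Adj x y
  · have hb : adj16 (siteEquiv x) (siteEquiv y) = true := (adj16_iff x y).2 hadj
    by_cases hx : Nat.testBit (rep9 ρ) (siteEquiv x) = true
    · by_cases hy : Nat.testBit (rep9 ρ) (siteEquiv y) = true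
      · obtain ⟨hpx, hltx⟩ := hch (siteEquiv x) (siteEquiv x).isLt hx
        obtain ⟨hpy, hlty⟩ := hch (siteEquiv y) (siteEquiv y).isLt hy
        rw [if_pos ⟨hadj, (decode_eq_one_iff _ _).2 hx, (decode_eq_one_iff _ _).2 hy⟩, hb, hx, hy]
        simp only [Bool.and_self, cond_true, Option.elim_some]
        rw [decode_clearBit _ _ hx, decode_clearBit _ _ hy, ha.classValue hltx hpx, ha.classValue hlty hpy]; ring
      · have hy' : Nat.testBit (rep9 ρ) (siteEquiv y) = false := by simpa using hy
        rw [if_neg (fun h => hy ((decode_eq_one_iff _ _).1 h.2.2)), hb, hx, hy']; rfl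
    · have hx' : Nat.testBit (rep9 ρ) (siteEquiv x) = false := by simpa using hx
      rw [if_neg (fun h => hx ((decode_eq_one_iff _ _).1 h.2.1)), hb, hx']; simp
  · have hb : adj16 (siteEquiv x) (siteEquiv y) = false := by
      cases h' : adj16 (siteEquiv x) (siteEquiv y)
      · rfl
      · exact absurd ((adj16_iff x y).1 h') hadj
    rw [if_neg (fun h => hadj h.1), hb]; simp

/-- **the graph form in class variables** for a symmetric amplitude. [folklore] -/
theorem SymAmp.inner_fmOp_eq_classes (ha : SymAmp a) :
    ∑ σ, a σ * fmOp (torusGraph 2 4) a σ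
      = (1/4 : ℝ) * ∑ ρ ∈ range 56, (n9 ρ : ℝ) * ((ordPairs ρ).map fun pq => (a (decode (rep8 pq.1)) - a (decode (rep8 pq.2))) ^ 2).sum := by
  rw [inner_fmOp_eq_pairForm, sum_config_eq_sum_range, ← sum_sector9]
  refine congrArg (fun s : ℝ => (1/4 : ℝ) * s) ?_
  refine Finset.sum_congr rfl fun k hk => ?_
  have hk' := mem_range.1 hk
  by_cases hp : pop16 k = 9
  · rw [if_pos hp, ha.pairForm_decode_class hk' hp, ha.pairForm_decode_rep9 (check9_facts hk' hp).1]
  · rw [if_neg hp, ha.pairForm_decode_eq_zero hk' hp]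

/-! ## Summary in the reduced forms of `…FerroSideChordFour` -/

/-- for a symmetric amplitude with class values `v`: `Σa² = N(v)`, `Σ W a² = W(v)`, `‖S⁻a‖² = L(v)`, `Σ a·Aa = A(v)`. [folklore] -/
theorem SymAmp.forms (ha : SymAmp a) :
    (∑ σ, a σ ^ 2 = normC (fun r => a (decode (rep8 r)))) ∧
    (∑ σ, isingW (torusGraph 2 4) σ * a σ ^ 2 = isingC (fun r => a (decode (rep8 r)))) ∧
    (lowerNormSq a = lowerC (fun r => a (decode (rep8 r)))) ∧
    (∑ σ, a σ * fmOp (torusGraph 2 4) a σ = hopC (fun r => a (decode (rep8 r)))) := by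
  refine ⟨?_, ?_, ?_, ?_⟩
  · unfold normC; rw [ha.sum_sq_eq_classes]
  · unfold isingC; rw [ha.sum_isingW_sq_eq_classes]
  · unfold lowerC; rw [ha.lowerNormSq_eq_classes]
  · unfold hopC; rw [ha.inner_fmOp_eq_classes]

end Summit.HubbardSuperconductivity.HubbardSuperconductivity.Theorems.AnisotropyChord.FourTorus
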